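import Summits.CriticalPhenomena.PercolationContinuityZ3.Theorems.PercNearOneGluingNoHeavyLowerTailSahiCTCRtThreeWindowThreeDefs
import HarnessLib

/-!
# `NoHeavyLowerTail` (crux stmt-CriticalPhenomena-4575), P3 lane: the SIXTEEN WEIGHT POLYNOMIALS of the three-point window of ROW 1

Support file (seat `prim-l12-p3`, gen 51; `--supports stmt-CriticalPhenomena-4575`).  Memo
`run/shared/lean/prim/prim-l12/FROM-prim-l12-p3-g51-ROW0-ALL-K-LEAN.md` §5.  Row-1 twin of `…RtThreeWindowFourPoly`: with `Dfac₅ j = 2k(k−1)⋯(k−5)` at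
`k = j + 5`, `WlocT_three_expand` / `WlocT_two_expand`, `poly_A**`, `poly_B**`, `poly_P*` (`Dfac₅·WlocT = Σ_i SA/SB·j^i`, `Dfac₅/C = Σ_i SP3·j^i`, by
`field_simp; ring`), `poly_A`, `poly_B`, `poly_P`, and `loc_poly₃` (the cleared local quantity as a polynomial in `j` whose coefficients are the linear forms
of the tables in the moments).  No new definitions; nothing is asserted about the crux.
-/

noncomputable section

open scoped Classical

namespace Summit.CriticalPhenomena.PercolationContinuityZ3.Theorems.SahiCTCForms

open Finset MvPolynomial SahiCTCGenFun

/-! ## Part POLY (row 1): the sixteen weight polynomials at `k = j + 5` -/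

namespace RtThreeFin3

/-- `C(m+2,2)` in `ℚ`, subtraction-free. [folklore] -/
private theorem cast_choose_two_add (m : ℕ) : (((m + 2).choose 2 : ℕ) : ℚ) = ((m : ℚ) + 2) * ((m : ℚ) + 1) / 2 := by
  rw [Nat.cast_choose_two]; push_cast; ring

/-- `WlocT 3` at `k = j + 5` with the case distinctions resolved (`t ≤ 3`, `s ≤ 2`). [this work] -/
theorem WlocT_three_expand (j t s : ℕ) (ht : t ≤ 3) (hs : s ≤ 2) :
    WlocT 3 (j + 5) t s =
      ((((j + 5 - t).choose 0 : ℕ) : ℚ) * ((((j + 5 : ℕ) : ℚ)) * ((((j + 4).choose s : ℕ) : ℚ)))⁻¹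
        + (((j + 5 - t).choose 1 : ℕ) : ℚ) * ((((j + 4 : ℕ) : ℚ)) * ((((j + 3).choose s : ℕ) : ℚ)))⁻¹
        + (((j + 5 - t).choose 2 : ℕ) : ℚ) * ((((j + 3 : ℕ) : ℚ)) * ((((j + 2).choose s : ℕ) : ℚ)))⁻¹)
      / (((j + 5 - t).choose (3 - t) : ℕ) : ℚ) := by
  have e1 : j + 5 - 1 = j + 4 := by omega
  have e2 : j + 5 - 2 = j + 3 := by omega
  have e3 : j + 4 - 1 = j + 3 := by omega
  have e4 : j + 3 - 1 = j + 2 := by omega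
  unfold WlocT
  rw [if_neg (by omega)]
  simp only [sum_range_succ, sum_range_zero, zero_add, Nat.sub_zero, e1, e2, e3, e4]
  rw [if_pos (by omega), if_pos (by omega), if_pos (by omega)]

/-- `WlocT 2` at `k = j + 5` with the case distinctions resolved (`t ≤ 3`, `s ≤ 2`). [this work] -/
theorem WlocT_two_expand (j t s : ℕ) (ht : t ≤ 3) (hs : s ≤ 2) :
    WlocT 2 (j + 5) t s =
      ((((j + 5 - t).choose 0 : ℕ) : ℚ) * ((((j + 5 : ℕ) : ℚ)) * ((((j + 4).choose s : ℕ) : ℚ)))⁻¹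
        + (((j + 5 - t).choose 1 : ℕ) : ℚ) * ((((j + 4 : ℕ) : ℚ)) * ((((j + 3).choose s : ℕ) : ℚ)))⁻¹)
      / (((j + 5 - t).choose (3 - t) : ℕ) : ℚ) := by
  have e1 : j + 5 - 1 = j + 4 := by omega
  have e3 : j + 4 - 1 = j + 3 := by omega
  unfold WlocT
  rw [if_neg (by omega)]
  simp only [sum_range_succ, sum_range_zero, zero_add, Nat.sub_zero, e1, e3]
  rw [if_pos (by omega), if_pos (by omega)]


/-- `C(m+3,3)` in `ℚ`, subtraction-free. [folklore] -/
private theorem cast_choose_three_add (m : ℕ) : (((m + 3).choose 3 : ℕ) : ℚ) = ((m : ℚ) + 3) * ((m : ℚ) + 2) * ((m : ℚ) + 1) / 6 := by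
  have h : ∀ m : ℕ, ((m.choose 3 : ℕ) : ℚ) = (m : ℚ) * ((m : ℚ) - 1) * ((m : ℚ) - 2) / 6 := by
    intro m
    induction m with
    | zero => simp
    | succ m ih => rw [Nat.choose_succ_succ, Nat.cast_add, ih, Nat.cast_choose_two]; push_cast; ring
  rw [h]; push_cast; ring

/-- Class `A(1,0)`: `WlocT 3 · Dfac₅` at `k = j + 5` is the polynomial with coefficients `SA 1 0`. [this work] -/
theorem poly_A10 (j : ℕ) : WlocT 3 (j + 5) 1 0 * Dfac₅ j = ∑ i ∈ range 8, ((SA 1 0 i : ℤ) : ℚ) * (j : ℚ) ^ i := by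
  rw [WlocT_three_expand j 1 0 (by norm_num) (by norm_num), show j + 5 - 1 = j + 4 by omega]
  simp [cast_choose_two_add, sum_range_succ, SA, SAl, Dfac₅]
  field_simp
  ring

/-- Class `A(2,0)`: `WlocT 3 · Dfac₅` at `k = j + 5` is the polynomial with coefficients `SA 2 0`. [this work] -/
theorem poly_A20 (j : ℕ) : WlocT 3 (j + 5) 2 0 * Dfac₅ j = ∑ i ∈ range 8, ((SA 2 0 i : ℤ) : ℚ) * (j : ℚ) ^ i := by
  rw [WlocT_three_expand j 2 0 (by norm_num) (by norm_num), show j + 5 - 2 = j + 3 by omega]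
  simp [cast_choose_two_add, sum_range_succ, SA, SAl, Dfac₅]
  field_simp
  ring

/-- Class `A(2,1)`: `WlocT 3 · Dfac₅` at `k = j + 5` is the polynomial with coefficients `SA 2 1`. [this work] -/
theorem poly_A21 (j : ℕ) : WlocT 3 (j + 5) 2 1 * Dfac₅ j = ∑ i ∈ range 8, ((SA 2 1 i : ℤ) : ℚ) * (j : ℚ) ^ i := by
  rw [WlocT_three_expand j 2 1 (by norm_num) (by norm_num), show j + 5 - 2 = j + 3 by omega]
  simp [cast_choose_two_add, sum_range_succ, SA, SAl, Dfac₅]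
  field_simp
  ring

/-- Class `A(3,0)`: `WlocT 3 · Dfac₅` at `k = j + 5` is the polynomial with coefficients `SA 3 0`. [this work] -/
theorem poly_A30 (j : ℕ) : WlocT 3 (j + 5) 3 0 * Dfac₅ j = ∑ i ∈ range 8, ((SA 3 0 i : ℤ) : ℚ) * (j : ℚ) ^ i := by
  rw [WlocT_three_expand j 3 0 (by norm_num) (by norm_num), show j + 5 - 3 = j + 2 by omega]
  simp [cast_choose_two_add, sum_range_succ, SA, SAl, Dfac₅]
  field_simp
  ring

/-- Class `A(3,1)`: `WlocT 3 · Dfac₅` at `k = j + 5` is the polynomial with coefficients `SA 3 1`. [this work] -/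
theorem poly_A31 (j : ℕ) : WlocT 3 (j + 5) 3 1 * Dfac₅ j = ∑ i ∈ range 8, ((SA 3 1 i : ℤ) : ℚ) * (j : ℚ) ^ i := by
  rw [WlocT_three_expand j 3 1 (by norm_num) (by norm_num), show j + 5 - 3 = j + 2 by omega]
  simp [cast_choose_two_add, sum_range_succ, SA, SAl, Dfac₅]
  field_simp
  ring

/-- Class `A(3,2)`: `WlocT 3 · Dfac₅` at `k = j + 5` is the polynomial with coefficients `SA 3 2`. [this work] -/
theorem poly_A32 (j : ℕ) : WlocT 3 (j + 5) 3 2 * Dfac₅ j = ∑ i ∈ range 8, ((SA 3 2 i : ℤ) : ℚ) * (j : ℚ) ^ i := by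
  rw [WlocT_three_expand j 3 2 (by norm_num) (by norm_num), show j + 5 - 3 = j + 2 by omega]
  simp [cast_choose_two_add, sum_range_succ, SA, SAl, Dfac₅]
  field_simp
  ring

/-- Class `B(1,0)`: `WlocT 2 · Dfac₅` at `k = j + 5` is the polynomial with coefficients `SB 1 0`. [this work] -/
theorem poly_B10 (j : ℕ) : WlocT 2 (j + 5) 1 0 * Dfac₅ j = ∑ i ∈ range 8, ((SB 1 0 i : ℤ) : ℚ) * (j : ℚ) ^ i := by
  rw [WlocT_two_expand j 1 0 (by norm_num) (by norm_num), show j + 5 - 1 = j + 4 by omega]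
  simp [cast_choose_two_add, sum_range_succ, SB, SBl, Dfac₅]
  field_simp
  ring

/-- Class `B(2,0)`: `WlocT 2 · Dfac₅` at `k = j + 5` is the polynomial with coefficients `SB 2 0`. [this work] -/
theorem poly_B20 (j : ℕ) : WlocT 2 (j + 5) 2 0 * Dfac₅ j = ∑ i ∈ range 8, ((SB 2 0 i : ℤ) : ℚ) * (j : ℚ) ^ i := by
  rw [WlocT_two_expand j 2 0 (by norm_num) (by norm_num), show j + 5 - 2 = j + 3 by omega]
  simp [sum_range_succ, SB, SBl, Dfac₅]
  field_simp
  ring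

/-- Class `B(2,1)`: `WlocT 2 · Dfac₅` at `k = j + 5` is the polynomial with coefficients `SB 2 1`. [this work] -/
theorem poly_B21 (j : ℕ) : WlocT 2 (j + 5) 2 1 * Dfac₅ j = ∑ i ∈ range 8, ((SB 2 1 i : ℤ) : ℚ) * (j : ℚ) ^ i := by
  rw [WlocT_two_expand j 2 1 (by norm_num) (by norm_num), show j + 5 - 2 = j + 3 by omega]
  simp [sum_range_succ, SB, SBl, Dfac₅]
  field_simp
  ring

/-- Class `B(3,0)`: `WlocT 2 · Dfac₅` at `k = j + 5` is the polynomial with coefficients `SB 3 0`. [this work] -/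
theorem poly_B30 (j : ℕ) : WlocT 2 (j + 5) 3 0 * Dfac₅ j = ∑ i ∈ range 8, ((SB 3 0 i : ℤ) : ℚ) * (j : ℚ) ^ i := by
  rw [WlocT_two_expand j 3 0 (by norm_num) (by norm_num), show j + 5 - 3 = j + 2 by omega]
  simp [sum_range_succ, SB, SBl, Dfac₅]
  field_simp
  ring

/-- Class `B(3,1)`: `WlocT 2 · Dfac₅` at `k = j + 5` is the polynomial with coefficients `SB 3 1`. [this work] -/
theorem poly_B31 (j : ℕ) : WlocT 2 (j + 5) 3 1 * Dfac₅ j = ∑ i ∈ range 8, ((SB 3 1 i : ℤ) : ℚ) * (j : ℚ) ^ i := by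
  rw [WlocT_two_expand j 3 1 (by norm_num) (by norm_num), show j + 5 - 3 = j + 2 by omega]
  simp [sum_range_succ, SB, SBl, Dfac₅]
  field_simp
  ring

/-- Class `B(3,2)`: `WlocT 2 · Dfac₅` at `k = j + 5` is the polynomial with coefficients `SB 3 2`. [this work] -/
theorem poly_B32 (j : ℕ) : WlocT 2 (j + 5) 3 2 * Dfac₅ j = ∑ i ∈ range 8, ((SB 3 2 i : ℤ) : ℚ) * (j : ℚ) ^ i := by
  rw [WlocT_two_expand j 3 2 (by norm_num) (by norm_num), show j + 5 - 3 = j + 2 by omega]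
  simp [cast_choose_two_add, sum_range_succ, SB, SBl, Dfac₅]
  field_simp
  ring

/-- Pair class `m = 0`: `Dfac₅ / C(k−0, 3)` at `k = j + 5` is the polynomial with coefficients `SP3 0`. [this work] -/
theorem poly_P0 (j : ℕ) : (1 / ((((j + 5 - 0).choose (3 - 0) : ℕ) : ℚ))) * Dfac₅ j = ∑ i ∈ range 8, ((SP3 0 i : ℤ) : ℚ) * (j : ℚ) ^ i := by
  rw [show j + 5 - 0 = j + 5 by omega]
  simp [cast_choose_three_add, sum_range_succ, SP3, SP3l, Dfac₅]
  field_simp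
  ring

/-- Pair class `m = 1`: `Dfac₅ / C(k−1, 2)` at `k = j + 5` is the polynomial with coefficients `SP3 1`. [this work] -/
theorem poly_P1 (j : ℕ) : (1 / ((((j + 5 - 1).choose (3 - 1) : ℕ) : ℚ))) * Dfac₅ j = ∑ i ∈ range 8, ((SP3 1 i : ℤ) : ℚ) * (j : ℚ) ^ i := by
  rw [show j + 5 - 1 = j + 4 by omega]
  simp [cast_choose_two_add, sum_range_succ, SP3, SP3l, Dfac₅]
  field_simp
  ring

/-- Pair class `m = 2`: `Dfac₅ / C(k−2, 1)` at `k = j + 5` is the polynomial with coefficients `SP3 2`. [this work] -/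
theorem poly_P2 (j : ℕ) : (1 / ((((j + 5 - 2).choose (3 - 2) : ℕ) : ℚ))) * Dfac₅ j = ∑ i ∈ range 8, ((SP3 2 i : ℤ) : ℚ) * (j : ℚ) ^ i := by
  rw [show j + 5 - 2 = j + 3 by omega]
  simp [sum_range_succ, SP3, SP3l, Dfac₅]
  field_simp
  ring

/-- Pair class `m = 3`: `Dfac₅ / C(k−3, 0)` at `k = j + 5` is the polynomial with coefficients `SP3 3`. [this work] -/
theorem poly_P3 (j : ℕ) : (1 / ((((j + 5 - 3).choose (3 - 3) : ℕ) : ℚ))) * Dfac₅ j = ∑ i ∈ range 8, ((SP3 3 i : ℤ) : ℚ) * (j : ℚ) ^ i := by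
  rw [show j + 5 - 3 = j + 2 by omega]
  simp [sum_range_succ, SP3, SP3l, Dfac₅]
  field_simp
  ring

/-- All six `W_n`-classes at once. [this work] -/
theorem poly_A (j : ℕ) : ∀ c ∈ CL3l.toFinset, WlocT 3 (j + 5) c.1 c.2 * Dfac₅ j = ∑ i ∈ range 8, ((SA c.1 c.2 i : ℤ) : ℚ) * (j : ℚ) ^ i := by
  intro c hc
  simp only [CL3l, List.toFinset_cons, List.toFinset_nil, insert_empty_eq, mem_insert, mem_singleton] at hc
  rcases hc with rfl | rfl | rfl | rfl | rfl | rfl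
  exacts [poly_A10 j, poly_A20 j, poly_A21 j, poly_A30 j, poly_A31 j, poly_A32 j]

/-- All six `W¹_n`-classes at once. [this work] -/
theorem poly_B (j : ℕ) : ∀ c ∈ CL3l.toFinset, WlocT 2 (j + 5) c.1 c.2 * Dfac₅ j = ∑ i ∈ range 8, ((SB c.1 c.2 i : ℤ) : ℚ) * (j : ℚ) ^ i := by
  intro c hc
  simp only [CL3l, List.toFinset_cons, List.toFinset_nil, insert_empty_eq, mem_insert, mem_singleton] at hc
  rcases hc with rfl | rfl | rfl | rfl | rfl | rfl
  exacts [poly_B10 j, poly_B20 j, poly_B21 j, poly_B30 j, poly_B31 j, poly_B32 j]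

/-- All four pair classes at once. [this work] -/
theorem poly_P (j : ℕ) : ∀ m ∈ range 4, (1 / ((((j + 5 - m).choose (3 - m) : ℕ) : ℚ))) * Dfac₅ j = ∑ i ∈ range 8, ((SP3 m i : ℤ) : ℚ) * (j : ℚ) ^ i := by
  intro m hm
  have : m = 0 ∨ m = 1 ∨ m = 2 ∨ m = 3 := by have := mem_range.1 hm; omega
  rcases this with rfl | rfl | rfl | rfl
  exacts [poly_P0 j, poly_P1 j, poly_P2 j, poly_P3 j]

/-- **THE CLEARED LOCAL QUANTITY OF ROW 1 IS A POLYNOMIAL IN `j = k − 5` WHOSE COEFFICIENTS ARE THE LINEAR FORMS `Σ SA·MA + Σ SB·MB + Σ SP3·MW`.** [this work] -/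
theorem loc_poly₃ (j : ℕ) (MA MB : ℕ → ℕ → ℚ) (MW : ℕ → ℚ) :
    Dfac₅ j * (∑ c ∈ CL3l.toFinset, WlocT 3 (j + 5) c.1 c.2 * MA c.1 c.2 + ∑ c ∈ CL3l.toFinset, WlocT 2 (j + 5) c.1 c.2 * MB c.1 c.2
        + ∑ m ∈ range 4, (1 / ((((j + 5 - m).choose (3 - m) : ℕ) : ℚ))) * MW m) =
      ∑ i ∈ range 8, (∑ c ∈ CL3l.toFinset, ((SA c.1 c.2 i : ℤ) : ℚ) * MA c.1 c.2 + ∑ c ∈ CL3l.toFinset, ((SB c.1 c.2 i : ℤ) : ℚ) * MB c.1 c.2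
        + ∑ m ∈ range 4, ((SP3 m i : ℤ) : ℚ) * MW m) * (j : ℚ) ^ i := by
  have hA : ∀ c ∈ CL3l.toFinset, Dfac₅ j * (WlocT 3 (j + 5) c.1 c.2 * MA c.1 c.2) =
      ∑ i ∈ range 8, (((SA c.1 c.2 i : ℤ) : ℚ) * MA c.1 c.2) * (j : ℚ) ^ i := fun c hc => by
    rw [← mul_assoc, mul_comm (Dfac₅ j), poly_A j c hc, sum_mul]
    exact sum_congr rfl fun i _ => by ring
  have hB : ∀ c ∈ CL3l.toFinset, Dfac₅ j * (WlocT 2 (j + 5) c.1 c.2 * MB c.1 c.2) =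
      ∑ i ∈ range 8, (((SB c.1 c.2 i : ℤ) : ℚ) * MB c.1 c.2) * (j : ℚ) ^ i := fun c hc => by
    rw [← mul_assoc, mul_comm (Dfac₅ j), poly_B j c hc, sum_mul]
    exact sum_congr rfl fun i _ => by ring
  have hP : ∀ m ∈ range 4, Dfac₅ j * ((1 / ((((j + 5 - m).choose (3 - m) : ℕ) : ℚ))) * MW m) =
      ∑ i ∈ range 8, (((SP3 m i : ℤ) : ℚ) * MW m) * (j : ℚ) ^ i := fun m hm => by
    rw [← mul_assoc, mul_comm (Dfac₅ j), poly_P j m hm, sum_mul]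
    exact sum_congr rfl fun i _ => by ring
  rw [mul_add, mul_add, mul_sum, mul_sum, mul_sum, sum_congr rfl hA, sum_congr rfl hB, sum_congr rfl hP, sum_comm, sum_comm (s := CL3l.toFinset),
    sum_comm (s := range 4), ← sum_add_distrib, ← sum_add_distrib]
  refine sum_congr rfl fun i _ => ?_
  rw [add_mul, add_mul, sum_mul, sum_mul, sum_mul]

end RtThreeFin3

end Summit.CriticalPhenomena.PercolationContinuityZ3.Theorems.SahiCTCForms
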